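import Mathlib
import Summits.NavierStokesRegularity.NavierStokesRegularity.Theorems.StretchingWellBindingDssProfileBindingSlice
import Literature.Analysis.FluidPDE.VorticityEquation
import Literature.Analysis.FluidPDE.SpaceTimeCalculus
import HarnessLib

/-!
# Route StretchingWellBinding — support item `DssProfileBinding` (stmt-NavierStokesRegularity-1578),
  helper file 2/4: the whole-space enstrophy identity for decaying classical ancient solutions

For a classical solution `(u, p)` of unforced Navier–Stokes (viscosity `ν`) on `EuclideanSpace ℝ (Fin 3) × (−∞, 0)` with
the scale-invariant decay `(‖x‖ + √(−t))^{k+1} ‖Dᵏu(t)(x)‖ ≤ C_k` at all orders (the hypothesis of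
`Theses.StretchingWellBinding.DssProfileBinding`, Chae–Wolf's Type-I class; only `k ≤ 3` is used),
the enstrophy `Ω(t) = ∫ ‖ω(t,x)‖² dx`, `ω = curl u`, is differentiable at every `t < 0` with
`Ω'(t) = 2 ( ∫ ⟪ω, Du ω⟫ − ν ∫ |∇ω|²_F )`:
pair the vorticity equation `∂ₜω + (u·∇)ω = (ω·∇)u + νΔω`
(`IsClassicalNSSolutionOn.isVorticitySolutionOn_zero_force`) with `ω`, differentiate under the
integral by dominated convergence — the domination `‖2⟪ω, ∂ₜω⟫‖ ≲ (1 + ‖x‖)^{−4}` is uniform on the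
time neighbourhood `(−∞, t/2)` by `exists_sliceBounds` — and use the slice identity of file 1/4.
Physical-variables twin of the tree's `SimilarityEnstrophy.similarityEnstrophy_hasDerivAt`
(Majda–Bertozzi, Prop. 1.13 / eq. (2.110) folklore).

* `sliceDecay_of_scaleInvariantDecay`, `exists_sliceBounds`: (D) gives slice decay
  `‖Dᵏu(σ)(x)‖ ≲ (1 + ‖x‖)^{−(k+1)}` uniformly on `σ ≤ σ₀ < 0`;
* `enstrophy_hasDerivAt`: the identity.

HONEST FRAMING: bookkeeping about a HYPOTHETICAL decaying ancient solution; no such object is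
asserted to exist; nothing here bears on Navier–Stokes regularity. Lands
`--supports stmt-NavierStokesRegularity-1578` (other route; label-free; typer seat g19 of cell
pub-ns-dss, idle-row item).
-/

noncomputable section

set_option linter.dupNamespace false

namespace Summit.NavierStokesRegularity.NavierStokesRegularity.Theorems.DssBinding

open MeasureTheory Set Filter Topology Module Metric InnerProductSpace Function
open scoped RealInnerProductSpace Laplacian ContDiff
open Literature.Analysis Literature.Analysis.FluidPDE
open Summit.NavierStokesRegularity.NavierStokesRegularity.Theorems.SimilarityEnstrophy
open Summit.NavierStokesRegularity.NavierStokesRegularity.Theorems.PlanarEnergyAPriori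

/-! ### The scale-invariant decay hypothesis gives slice decay, uniformly on `t ≤ σ₀ < 0` -/

/-- **Slice decay from (D):** if `(‖x‖ + √(−t))^{k+1} ‖Dᵏu(t)(x)‖ ≤ C` for all `t < 0` and
`0 < m ≤ 1`, `m ≤ √(−σ)`, then `‖Dᵏu(σ)(x)‖ ≤ (C / m^{k+1}) (1 + ‖x‖)^{−(k+1)}`
(`m(1 + ‖x‖) ≤ ‖x‖ + √(−σ)`). [folklore] -/
theorem sliceDecay_of_scaleInvariantDecay {u : ℝ → EuclideanSpace ℝ (Fin 3) → EuclideanSpace ℝ (Fin 3)} {k : ℕ} {C m σ : ℝ}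
    (hD : ∀ t < 0, ∀ x, (‖x‖ + Real.sqrt (-t)) ^ (k + 1) * ‖iteratedFDeriv ℝ k (u t) x‖ ≤ C)
    (hm0 : 0 < m) (hm1 : m ≤ 1) (hσ : σ < 0) (hmσ : m ≤ Real.sqrt (-σ)) (x : EuclideanSpace ℝ (Fin 3)) :
    ‖iteratedFDeriv ℝ k (u σ) x‖ ≤ C / m ^ (k + 1) * (1 + ‖x‖) ^ (-((k : ℝ) + 1)) := by
  have hx : 0 ≤ ‖x‖ := norm_nonneg x
  have hle : m * (1 + ‖x‖) ≤ ‖x‖ + Real.sqrt (-σ) := by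
    nlinarith [mul_nonneg (sub_nonneg.2 hm1) hx]
  have hpow : (m * (1 + ‖x‖)) ^ (k + 1) ≤ (‖x‖ + Real.sqrt (-σ)) ^ (k + 1) :=
    pow_le_pow_left₀ (by positivity) hle _
  have hmk : 0 < m ^ (k + 1) := pow_pos hm0 _
  have hA : 0 < (1 + ‖x‖) ^ (k + 1) := by positivity
  have hconv : (1 + ‖x‖) ^ (-((k : ℝ) + 1)) = ((1 + ‖x‖) ^ (k + 1))⁻¹ := by
    rw [Real.rpow_neg (by positivity), show ((k : ℝ) + 1) = ((k + 1 : ℕ) : ℝ) by push_cast; ring,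
      Real.rpow_natCast]
  rw [hconv, show C / m ^ (k + 1) * ((1 + ‖x‖) ^ (k + 1))⁻¹ =
      C / (m ^ (k + 1) * (1 + ‖x‖) ^ (k + 1)) by field_simp, le_div_iff₀ (mul_pos hmk hA)]
  calc ‖iteratedFDeriv ℝ k (u σ) x‖ * (m ^ (k + 1) * (1 + ‖x‖) ^ (k + 1))
      = (m * (1 + ‖x‖)) ^ (k + 1) * ‖iteratedFDeriv ℝ k (u σ) x‖ := by rw [mul_pow]; ring
    _ ≤ (‖x‖ + Real.sqrt (-σ)) ^ (k + 1) * ‖iteratedFDeriv ℝ k (u σ) x‖ :=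
        mul_le_mul_of_nonneg_right hpow (norm_nonneg _)
    _ ≤ C := hD σ hσ x

/-! ### The enstrophy identity for decaying classical ancient solutions -/

section Ancient

variable {ν : ℝ} {u : ℝ → EuclideanSpace ℝ (Fin 3) → EuclideanSpace ℝ (Fin 3)} {p : ℝ → EuclideanSpace ℝ (Fin 3) → ℝ}

/-- **Uniform slice bounds below a negative time.** Under (D) at orders `0,…,3`, for every `σ₀ < 0`
there are constants `K₀,…,K₃` with `‖u(σ)(x)‖ ≤ K₀(1+‖x‖)^{−1} ≤ K₀`, `‖Du(σ)(x)‖ ≤ K₁(1+‖x‖)^{−2}`,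
`‖D²u(σ)(x)‖ ≤ K₂(1+‖x‖)^{−3}`, `‖D³u(σ)(x)‖ ≤ K₃(1+‖x‖)^{−4}` for all `σ ≤ σ₀`. [folklore] -/
theorem exists_sliceBounds
    (hD : ∀ k : ℕ, ∃ C : ℝ, ∀ t < 0, ∀ x,
      (‖x‖ + Real.sqrt (-t)) ^ (k + 1) * ‖iteratedFDeriv ℝ k (u t) x‖ ≤ C)
    {σ₀ : ℝ} (hσ₀ : σ₀ < 0) :
    ∃ K₀ K₁ K₂ K₃ : ℝ, ∀ σ ≤ σ₀,
      (∀ x, ‖u σ x‖ ≤ K₀ * (1 + ‖x‖) ^ (-(1 : ℝ))) ∧ (∀ x, ‖u σ x‖ ≤ K₀) ∧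
      (∀ x, ‖fderiv ℝ (u σ) x‖ ≤ K₁ * (1 + ‖x‖) ^ (-(2 : ℝ))) ∧
      (∀ x, ‖iteratedFDeriv ℝ 2 (u σ) x‖ ≤ K₂ * (1 + ‖x‖) ^ (-(3 : ℝ))) ∧
      (∀ x, ‖iteratedFDeriv ℝ 3 (u σ) x‖ ≤ K₃ * (1 + ‖x‖) ^ (-(4 : ℝ))) := by
  obtain ⟨C₀, hC₀⟩ := hD 0
  obtain ⟨C₁, hC₁⟩ := hD 1
  obtain ⟨C₂, hC₂⟩ := hD 2
  obtain ⟨C₃, hC₃⟩ := hD 3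
  set m : ℝ := min 1 (Real.sqrt (-σ₀)) with hm
  have hm0 : 0 < m := lt_min one_pos (Real.sqrt_pos.2 (neg_pos.2 hσ₀))
  have hm1 : m ≤ 1 := min_le_left _ _
  have hmσ : ∀ {σ : ℝ}, σ ≤ σ₀ → m ≤ Real.sqrt (-σ) := fun {σ} hσ =>
    (min_le_right _ _).trans (Real.sqrt_le_sqrt (by linarith))
  have hneg : ∀ {σ : ℝ}, σ ≤ σ₀ → σ < 0 := fun {σ} hσ => hσ.trans_lt hσ₀
  have hC₀0 : 0 ≤ C₀ := decayConst_nonneg hC₀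
  refine ⟨C₀ / m ^ (0 + 1), C₁ / m ^ (1 + 1), C₂ / m ^ (2 + 1), C₃ / m ^ (3 + 1),
    fun σ hσ => ⟨fun x => ?_, fun x => ?_, fun x => ?_, fun x => ?_, fun x => ?_⟩⟩
  · have h := sliceDecay_of_scaleInvariantDecay hC₀ hm0 hm1 (hneg hσ) (hmσ hσ) x
    rw [norm_iteratedFDeriv_zero, show (-(((0 : ℕ) : ℝ) + 1)) = (-(1 : ℝ)) by norm_num] at h
    exact h
  · have h := sliceDecay_of_scaleInvariantDecay hC₀ hm0 hm1 (hneg hσ) (hmσ hσ) x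
    rw [norm_iteratedFDeriv_zero] at h
    refine h.trans ?_
    have hK : 0 ≤ C₀ / m ^ (0 + 1) := by positivity
    have hw : (1 + ‖x‖) ^ (-(((0 : ℕ) : ℝ) + 1)) ≤ 1 :=
      Real.rpow_le_one_of_one_le_of_nonpos (by simp) (by norm_num)
    simpa using mul_le_mul_of_nonneg_left hw hK
  · have h := sliceDecay_of_scaleInvariantDecay hC₁ hm0 hm1 (hneg hσ) (hmσ hσ) x
    rw [norm_iteratedFDeriv_one, show (-(((1 : ℕ) : ℝ) + 1)) = (-(2 : ℝ)) by norm_num] at h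
    exact h
  · have h := sliceDecay_of_scaleInvariantDecay hC₂ hm0 hm1 (hneg hσ) (hmσ hσ) x
    rw [show (-(((2 : ℕ) : ℝ) + 1)) = (-(3 : ℝ)) by norm_num] at h
    exact h
  · have h := sliceDecay_of_scaleInvariantDecay hC₃ hm0 hm1 (hneg hσ) (hmσ hσ) x
    rw [show (-(((3 : ℕ) : ℝ) + 1)) = (-(4 : ℝ)) by norm_num] at h
    exact h

/-- **The enstrophy identity.** For a classical solution `(u, p)` of unforced Navier–Stokes
(viscosity `ν`) on `EuclideanSpace ℝ (Fin 3) × (−∞, 0)` with the scale-invariant decay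
`(‖x‖ + √(−t))^{k+1} ‖Dᵏu(t)(x)‖ ≤ C_k` at all orders (only `k ≤ 3` is used), the enstrophy
`Ω(t) = ∫ ‖curl u(t)‖²` is differentiable at every `t < 0` with
`Ω'(t) = 2 (∫⟪ω, Du ω⟫ − ν ∫|∇ω|²_F)`, `ω = curl u(t)` (Majda–Bertozzi, Prop. 1.13-type
bookkeeping for the vorticity equation (2.110): dominated differentiation under the integral on the
time neighbourhood `(−∞, t/2)`, then the whole-space integrations by parts
`∫⟪Δω, ω⟫ = −∫|∇ω|²_F`, `∫⟪(u·∇)ω, ω⟫ = 0`). [folklore] -/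
theorem enstrophy_hasDerivAt (hsol : IsClassicalNSSolutionOn (Iio 0) ν 0 u p)
    (hD : ∀ k : ℕ, ∃ C : ℝ, ∀ t < 0, ∀ x,
      (‖x‖ + Real.sqrt (-t)) ^ (k + 1) * ‖iteratedFDeriv ℝ k (u t) x‖ ≤ C)
    {t : ℝ} (ht : t < 0) :
    HasDerivAt (fun σ => ∫ x, ‖curl (u σ) x‖ ^ 2)
      (2 * ((∫ x, ⟪curl (u t) x, fderiv ℝ (u t) x (curl (u t) x)⟫)
        - ν * ∫ x, frobeniusNormSq (fderiv ℝ (curl (u t)) x))) t := by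
  -- uniform slice bounds on `σ ≤ σ₀ := t/2`
  set σ₀ : ℝ := t / 2 with hσ₀def
  have hσ₀ : σ₀ < 0 := by rw [hσ₀def]; linarith
  have htσ₀ : t < σ₀ := by rw [hσ₀def]; linarith
  obtain ⟨K₀, K₁, K₂, K₃, hK⟩ := exists_sliceBounds hD hσ₀
  -- smoothness and the vorticity equation on the open time set `(−∞, 0)`
  have hsm : IsSmoothSpaceTimeOn (Iio 0) u := hsol.smooth_velocity
  have hu : ∀ {σ : ℝ}, σ < 0 → ContDiff ℝ ∞ (u σ) := fun {σ} hσ => hsol.contDiff_velocity hσ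
  have hω : ∀ {σ : ℝ}, σ < 0 → ContDiff ℝ ∞ (curl (u σ)) := fun {σ} hσ =>
    contDiff_curl_smooth (hu hσ)
  have hvort : IsSmoothSpaceTimeOn (Iio 0) (vorticity u) := by
    have h1 := (hsm.isSmoothSpaceTimeOn_fderiv_of_isOpen isOpen_Iio).clm curlCLM
    have e : (fun t x => curlCLM (fderiv ℝ (u t) x)) = vorticity u := by funext s y; rfl
    rwa [e] at h1
  have hV := hsol.isVorticitySolutionOn_zero_force isOpen_Iio.uniqueDiffOn
    (by rw [interior_Iio]; exact subset_closure)
  -- the right-hand side `R = νΔω − Dω(u) + Du(ω)` of the vorticity equation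
  set R : ℝ → EuclideanSpace ℝ (Fin 3) → EuclideanSpace ℝ (Fin 3) := fun σ x => ν • (Δ (curl (u σ))) x
    - fderiv ℝ (curl (u σ)) x (u σ x) + fderiv ℝ (u σ) x (curl (u σ) x) with hRdef
  have hveq : ∀ {σ : ℝ}, σ < 0 → ∀ x, deriv (fun s => curl (u s) x) σ = R σ x := by
    intro σ hσ x
    have h := hV.vorticity_eq σ hσ x
    simp only [timeDerivWithin_eq_deriv isOpen_Iio hσ, convect_apply, vorticity_apply] at h
    calc deriv (fun s => curl (u s) x) σ
        = (fderiv ℝ (u σ) x (curl (u σ) x) + ν • (Δ (curl (u σ))) x)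
            - fderiv ℝ (curl (u σ)) x (u σ x) := eq_sub_of_add_eq h
      _ = R σ x := by simp only [hRdef]; abel
  have cR : ∀ {σ : ℝ}, σ < 0 → Continuous (R σ) := by
    intro σ hσ
    have c1 : Continuous (Δ (curl (u σ))) := continuous_laplacian ((hω hσ).of_le (by norm_cast))
    have c2 : Continuous fun x => fderiv ℝ (curl (u σ)) x (u σ x) :=
      ((hω hσ).continuous_fderiv (by simp)).clm_apply (hu hσ).continuous
    have c3 : Continuous fun x => fderiv ℝ (u σ) x (curl (u σ) x) :=
      ((hu hσ).continuous_fderiv (by simp)).clm_apply (hω hσ).continuous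
    exact ((c1.const_smul ν).sub c2).add c3
  -- the constant of the right-hand-side bound
  set K : ℝ := |ν| * (3 * (‖curlCLM‖ * K₃)) + ‖curlCLM‖ * K₂ * K₀ + K₁ * (‖curlCLM‖ * K₁) with hKdef
  have hK₁0 : 0 ≤ K₁ := SlabLaw.nonneg_of_norm_le_rpow (hK t htσ₀.le).2.2.1
  -- dominated differentiation under the integral sign
  have h := hasDerivAt_integral_of_dominated_loc_of_deriv_le (μ := volume) (s := Iio σ₀)
    (F := fun σ x => ‖curl (u σ) x‖ ^ 2) (F' := fun σ x => 2 * ⟪curl (u σ) x, R σ x⟫)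
    (bound := fun x => 2 * ((‖curlCLM‖ * K₁) * K) * (1 + ‖x‖) ^ (-(4 : ℝ))) (x₀ := t)
    (isOpen_Iio.mem_nhds htσ₀) ?_ ?_ ?_ ?_ ?_ ?_
  · refine h.2.congr_deriv ?_
    obtain ⟨-, h0, h1, h2, h3⟩ := hK t htσ₀.le
    exact integral_enstrophyPairing_eq (hu ht) (hsol.divFree t ht) ν h0 h1 h2 h3
  · filter_upwards [isOpen_Iio.mem_nhds ht] with σ hσ
    exact (((hω hσ).continuous.norm).pow 2).aestronglyMeasurable
  · exact integrable_norm_curl_sq (hu ht) (hK t htσ₀.le).2.2.1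
  · exact (continuous_const.mul ((hω ht).continuous.inner (cR ht))).aestronglyMeasurable
  · refine Eventually.of_forall fun x σ hσ => ?_
    have hσ0 : σ < 0 := lt_trans hσ hσ₀
    obtain ⟨-, h0, h1, h2, h3⟩ := hK σ (le_of_lt hσ)
    have hR := norm_vorticityRHS_le_decay (hu hσ0) ν h0 h1 h2 h3 x
    have hΩb := norm_curl_le_decay h1 x
    have hΩ0 : 0 ≤ ‖curlCLM‖ * K₁ * (1 + ‖x‖) ^ (-(2 : ℝ)) := (norm_nonneg _).trans hΩb
    rw [norm_mul, Real.norm_of_nonneg (by norm_num : (0:ℝ) ≤ 2), mul_assoc, mul_assoc]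
    refine mul_le_mul_of_nonneg_left ?_ (by norm_num)
    calc ‖⟪curl (u σ) x, R σ x⟫‖ ≤ ‖curl (u σ) x‖ * ‖R σ x‖ := norm_inner_le_norm _ _
      _ ≤ (‖curlCLM‖ * K₁ * (1 + ‖x‖) ^ (-(2 : ℝ))) * (K * (1 + ‖x‖) ^ (-(2 : ℝ))) :=
          mul_le_mul hΩb hR (norm_nonneg _) hΩ0
      _ = ‖curlCLM‖ * K₁ * (K * (1 + ‖x‖) ^ (-(4 : ℝ))) := by
          rw [show (-(4 : ℝ)) = -((2 : ℝ) + 2) by norm_num, ← SlabLaw.rpow_neg_mul_rpow_neg]; ring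
  · have hcont : Continuous fun x : EuclideanSpace ℝ (Fin 3) => 2 * ((‖curlCLM‖ * K₁) * K) * (1 + ‖x‖) ^ (-(4 : ℝ)) :=
      continuous_const.mul ((continuous_const.add continuous_norm).rpow_const
        fun x => Or.inl (add_pos_of_pos_of_nonneg one_pos (norm_nonneg x)).ne')
    refine integrable_of_le_decay_four hcont (K := 2 * ((‖curlCLM‖ * K₁) * K)) fun x => ?_
    have hK0 : 0 ≤ K := by
      obtain ⟨-, h0, h1, h2, h3⟩ := hK t htσ₀.le
      have := (norm_nonneg _).trans (h0 0)
      have := SlabLaw.nonneg_of_norm_le_rpow h2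
      have := SlabLaw.nonneg_of_norm_le_rpow h3
      positivity
    rw [Real.norm_of_nonneg (by positivity)]
  · refine Eventually.of_forall fun x σ hσ => ?_
    have hσ0 : σ < 0 := lt_trans hσ hσ₀
    have h1 := hvort.hasDerivAt_timeLine isOpen_Iio hσ0 x
    simp only [vorticity_apply] at h1
    rw [hveq hσ0 x] at h1
    exact h1.norm_sq

end Ancient

end Summit.NavierStokesRegularity.NavierStokesRegularity.Theorems.DssBinding

end
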